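import Summits.Schanuel.Schanuel.Theorems.RootDecomp1KSuperellipticSiegel04

/-!
# RootDecomp1KSuperellipticSiegel — lens 1, generation 63, NODE 24 «SUPERELLIPTIC SIEGEL ON THE K-LINE — the lacunary dominant-far sector» (the superelliptic Siegel–LeVeque theorem y^m = f(x), m ≥ 3, f with two simple roots, over any number field — PROVED from the tree's unit equation via the cyclotomic–Kummer tower and Siegel's identity; the engine on DOMINANT LACUNARY pairs c_k(Y)·x^k + c₀(Y), k ≥ 3 ⇒ SiegelClause / LevelFinite / ThinFibreAt ∀ m₀ / BddLevelEmpty, intrinsically the class DomSuper P; the genus-six family T j := x³ − (Y⁷ + (4j+2)Y − (4j+2)) decided hypothesis-free ∀ j ∈ ℤ; the territory T_territory incl. 2-adic liveness by size at m₀ = 2; CLAIM L2927, PRICE L2930, K-R55) — continuation (RootDecomp1KSuperellipticSiegel05): §T part 1: coefficient read-backs, shape refusals, the deciders' negations at m₀ = 2 with GaussAt 3 and the ladder at 3, the anchor (1, 1) and the odd-prime sieves refused, real liveness (section Territory, to be continued in part 06)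

(lens-1 g63 NODE 24 «SUPERELLIPTIC SIEGEL ON THE K-LINE — the LACUNARY DOMINANT-FAR SECTOR» L2940/L2941: HOME kernel K = HOME/decomp-schanuel-lens-1/g63/lean/SuperellipticSiegel.lean sha256 f78e5b9a…, 1410 l, ONE namespace `Summit.Schanuel.Schanuel.Theorems.RootDecomp1KSuperellipticSiegel`, imports the tree port …RootDecomp1KHyperellipticSiegel05 ONLY (node 23's part 01 carries the PROVED Literature modules SiegelCubicReduction / UnitEquationFinite / SIntegersFiniteExtension; no …Proofs umbrella, no fact file); no private, no instance, no set_option, no notation, no sorry, no decide; CLAIM L2927, census LIVENESS-v29 (rows T 0 / T 17 tabled on request, OF RECORD L2931 with the critic's territory certificate; keys domSuper / ladder / superell / galtop), crit g12 PRICE L2930 (PAYABLE THEOREM ×1 EX ANTE for (L)+(E)+(F)+(T) jointly under RULE K-R54 (iii) — the superelliptic grade, the LAST credit on the integral-points lane; CHECKLIST K-g63 (1)–(11); RULE K-R55 PRE-ANNOUNCED), writer g33 NOTE 8 L2928 (pre-check 16/16), critic VERDICT: CLEARED — THEOREM ×1 for (L)+(E)+(F)+(T) JOINTLY, ONE credit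 (RULE K-R54 (iii), the superelliptic grade — the LAST credit on the integral-points lane), VERDICT L2943 (crit-1 g12, 2026-09-01T23:12Z): CHECKLIST K-g63 (1)–(11) met item by item on the critic's own farm runs (K rc 0 · 0 errors · 0 sorries; Probe rc 0 with 253 `#print axioms` guards ⊆ the standard triple; Ctrl0 rc 0; Ctrl rc 1 = exactly the 53 planted errors; L_standalone rc 0 ⇒ §L is K-line-independent modulo node 23's Literature-only part 01); TALLY lens-1 ×21 + THEOREM ×23; RULE K-R55 FIXED ((i) toolkit ∪= superelliptic integral-point Siegel — THE INTEGRAL-POINTS LANE IS CLOSED; (ii) open territory at m₀ = 2 := K-R54 (ii) territory not reached by (i): NON-DOMINANT (standing witness W4) and DOMINANT-FAR NON-LACUNARY (standing witness X3); (iii) payable clause; (iv) unconditional part ∪= the node-24 tree names after the port); PORT GO L2944 exactly as census STAGING NOTE 15 L2942 (six parts; the two docstring-preserving boundary moves approved; no privatisation). Port by census-1 gen 24 per NODE-g63.md §(11) as `RootDecomp1KSuperellipticSiegel01–06` (`--supports stmt-Schanuel-33364`; the item stays OPEN; no census credit): 01 = §L floors (section Local: the m-divisibility lemma `natCast_dvd_log_map_sub_of_pow_eq_mul_prod`,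 Siegel's factors / identity / ratio `geomSum_mul_sub_eq` / `map_sub_mul_eq_one` / `siegel_identity_pow` / `eq_of_ratio`; the cyclotomic + Kummer tower `exists_numberField_forall_mem_selmerGroup_isPow` / `exists_numberField_forall_isPow_of_dvd`; bad places `exists_finite_places`); 02 = §L main theorem `finite_integer_pow_eq_of_unitEquation` (U-binder verbatim as the tree's cubic case) + `finite_integer_pow_eq` (unconditional by `finite_unitEquation`) + `finite_integer_pow_eq_of_separable`; 03 = §E the engine on dominant LACUNARY pairs of x-degree k ≥ 3 (the `_lac` chain over node 23's `den_dvd_of_dyadic`, `def DomSuper`, `domSuper_xPolyP_iff` / `domSuper_twoTermP_iff`, the doors `siegelClause_of_domSuper` / `levelFinite_of_domSuper` / `thinFibreAt_of_domSuper` / `bddLevelEmpty_of_domSuper`, disjointness `not_domHyper_of_domSuper` / `not_domSuper_*`) (section Engine); 04 = §F the family `A j`, `tC`, `T j` (`T_eq_twoTermP`), `isEisensteinAt_A` ⇒ `domSuper_T` ⇒ `levelFinite_T` / `thinFibreAt_T` / `siegelClause_T` / … (section Family); 05 = §T part 1 (coefficient read-backs, shape refusals, the deciders' negations, GaussAt 3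 and the ladder at 3, the anchor (1, 1), the odd-prime sieves refused, real liveness) (section Territory, to be continued); 06 = §T part 2 ((T-2) `den_pow_seven_le_T` / `den_pow_lt_T` / `not_thin_ineq_two_T`, `thinFibreAt_two_iff_levelFinite_T`, `T_territory`, `T'` with `T'_zero` / `T'_one` / `T'_territory`) (section Territory re-opened with K's own open-lines). Literature / node-23 twins are CITED by name, never restated. Text = K VERBATIM (every declaration documented by the lens; statements and proofs unchanged; K's module docstring kept in part 01 below this provenance block).)
-/

noncomputable section

namespace Summit.Schanuel.Schanuel.Theorems.RootDecomp1KSuperellipticSiegel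

open Polynomial IsDedekindDomain NumberField
open scoped Classical WithZero
open Literature.NumberTheory.DiophantineGeometry (finite_unitEquation exists_finite_forall_mem_integer_algebraMap
  valuation_algebraMap_eq_one_of_mem_integer_inv valuation_eq_one_of_mul_eq_one)
open IsDedekindDomain.HeightOneSpectrum (setOf_valuation_ne_one_finite setOf_one_lt_valuation_finite)
open Summit.Schanuel.Schanuel.Theorems.RootDecomp1KHyperellipticSiegel (setOf_ne_and_valuation_sub_ne_one_finite)

/-! ### §T  TERRITORY OF THE FAMILY `T j` — REFUSED BY TYPE by every decider of the record at the residual quality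
`m₀ = 2` (nodes 6–23 and Runge), LOCALLY LIVE (a smooth rational point on level `1`), REAL-LIVE at every level,
2-ADICALLY LIVE at quality `2` ((T-2): `den(r)⁷ ≤ 2^{3·N!}` at every level point); node 13½'s ladder and node 15's
Gauss class reach it only from `m₀ = 3` on; and the THEOREMS, uniformly in `j`. -/

section Territory

open LiouvilleNumber
open scoped Nat
open Summit.Schanuel.Schanuel.Theorems.RootDecomp1KDegreeLadder
open Summit.Schanuel.Schanuel.Theorems.RootDecomp1KXLinear
open Summit.Schanuel.Schanuel.Theorems.RootDecomp1KXTop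
open Summit.Schanuel.Schanuel.Theorems.RootDecomp1KXAll
open Summit.Schanuel.Schanuel.Theorems.RootDecomp1KLevelFinite
open Summit.Schanuel.Schanuel.Theorems.RootDecomp1KThueMahler
open Summit.Schanuel.Schanuel.Theorems.RootDecomp1KLocalExponent
open Summit.Schanuel.Schanuel.Theorems.RootDecomp1KIntegrality (DomZero GaussAt gaussAt_xPolyP_iff thinFibreAt_of_gaussAt)
open Summit.Schanuel.Schanuel.Theorems.RootDecomp1KSubspaceBranch (SepTopAt)
open Summit.Schanuel.Schanuel.Theorems.RootDecomp1KHeightGrading (BddLevelEmpty bddLevelEmpty_iff_levelFinite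
  HeightDecidedAt)
open Summit.Schanuel.Schanuel.Theorems.RootDecomp1KDescent
open Summit.Schanuel.Schanuel.Theorems.RootDecomp1KCubicDescent
open Summit.Schanuel.Schanuel.Theorems.RootDecomp1KOddEmpty
open Summit.Schanuel.Schanuel.Theorems.RootDecomp1KSiegelGenusOne (SW sC)
open Summit.Schanuel.Schanuel.Theorems.RootDecomp1KTwoBaseCell (psNumer)
open Summit.Schanuel.Schanuel.Theorems.RootDecomp1KRelLiouvilleCell (partialSum_two_pos
  partialSum_two_lt_liouvilleNumber liouvilleNumber_two_lt)
open Summit.Schanuel.Schanuel.Theorems.RootDecomp1KRunge (RW rwC rwC_five)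
open Summit.Schanuel.Schanuel.Theorems.RootDecomp1KHyperellipticSiegel (den_dvd_of_dyadic ne_zero_of_domZero
  DomHyper M mC)

/-- `(j : ℤ) (i : ℕ) : xCoeff (T j) i = tC j i`. -/
theorem xCoeff_T (j : ℤ) (i : ℕ) : xCoeff (T j) i = tC j i := by
  rw [T, xCoeff_xPolyP]
  split_ifs with h
  · rfl
  · exact (tC_of_ne j (by omega) (by omega)).symm
/-- `(j : ℤ) : xdeg (T j) = 3`. -/
theorem xdeg_T (j : ℤ) : xdeg (T j) = 3 := by rw [T]; exact xdeg_xPolyP 3 _ (tC_three_ne_zero j)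
/-- `(j : ℤ) : topX (T j) = 1` — CONSTANT top (no `ℚ₂`-root, no root at all). -/
theorem topX_T (j : ℤ) : topX (T j) = 1 := by rw [T, topX_xPolyP 3 _ (tC_three_ne_zero j), tC_three]
/-- `(j : ℤ) : 7 ≤ (T j).natDegree`. -/
theorem seven_le_natDegree_T (j : ℤ) : 7 ≤ (T j).natDegree := by
  refine le_natDegree_of_ne_zero fun h => ?_
  have h1 := congrArg (fun q : ℤ[X] => q.coeff 0) h
  simp only [T, coeff_coeff_xPolyP, coeff_zero] at h1
  rw [if_pos (by simp), tC_zero, coeff_neg, coeff_A_seven] at h1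
  norm_num at h1
/-- `(j : ℤ) : (T j).natDegree = 7` — ODD `Y`-degree (REAL-LIVE at every abscissa). -/
theorem natDegree_T (j : ℤ) : (T j).natDegree = 7 := by
  refine le_antisymm ?_ (seven_le_natDegree_T j)
  rw [T]
  refine natDegree_xPolyP_le 3 _ 7 fun i hi => ?_
  interval_cases i
  · rw [tC_zero, natDegree_neg, natDegree_A]
  · rw [tC_of_ne j (by norm_num) (by norm_num), natDegree_zero]; norm_num
  · rw [tC_of_ne j (by norm_num) (by norm_num), natDegree_zero]; norm_num
  · rw [tC_three, natDegree_one]; norm_num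
/-- `(j : ℤ) : T j ≠ 0`. -/
theorem T_ne_zero (j : ℤ) : T j ≠ 0 := fun h => by
  have := seven_le_natDegree_T j; rw [h, natDegree_zero] at this; omega
/-- `(j : ℤ) : eTop (T j) = 7` — the top is `7` degrees SHORT of the `Y`-degree (Runge / node 11 / node 12c: `eTop ≤ 1`). -/
theorem eTop_T (j : ℤ) : eTop (T j) = 7 := by rw [eTop, natDegree_T, topX_T, natDegree_one]
/-- `(j : ℤ) : muTop (T j) = 0`. -/
theorem muTop_T (j : ℤ) : muTop (T j) = 0 := by
  have := muTop_le_natDegree (T j); rw [topX_T, natDegree_one] at this; omega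
/-- `(j : ℤ) : thinThreshold (T j) = 8` — the `x`-all threshold of node 13 decides `T j` only from `m₀ = 8` on. -/
theorem thinThreshold_T (j : ℤ) : thinThreshold (T j) = 8 := by
  rw [thinThreshold, muTop_T, eTop_T]; rfl
/-- `(j : ℤ) : ¬ (T j).natDegree < 2 * xdeg (T j)` — OUTSIDE node 12's height shape at `m₀ = 2` (`7 ≥ 6`). -/
theorem not_natDegree_T_lt (j : ℤ) : ¬ (T j).natDegree < 2 * xdeg (T j) := by rw [natDegree_T, xdeg_T]; norm_num
/-- `(j : ℤ) {m₀ : ℕ} (hm : m₀ ≤ 2) : ¬ HeightDecidedAt m₀ (T j)` — node 12's (conditional) height class refused at `m₀ ≤ 2`. -/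
theorem not_heightDecidedAt_T (j : ℤ) {m₀ : ℕ} (hm : m₀ ≤ 2) : ¬ HeightDecidedAt m₀ (T j) := fun h => by
  have := h.2; rw [natDegree_T, xdeg_T] at this; omega
/-- `(j : ℤ) {m₀ : ℕ} (hm : m₀ ≤ 7) : ¬ SepTopAt m₀ (T j)` — node 11's (conditional) subspace class refused (`eTop = 7`). -/
theorem not_sepTopAt_T (j : ℤ) {m₀ : ℕ} (hm : m₀ ≤ 7) : ¬ SepTopAt m₀ (T j) := fun h => by
  have := h.2; rw [eTop_T] at this; omega

/-- `T j` evaluated: `x³ − (y⁷ + (4j+2)·y − (4j+2))`. -/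
theorem bev_T (j : ℤ) (x y : ℝ) : bev (T j) x y = x ^ 3 - (y ^ 7 + (4 * j + 2) * y - (4 * j + 2)) := by
  rw [T, bev_xPolyP_lac 3 (tC j) (by norm_num) (tC_lac j), tC_zero, tC_three, map_neg, aeval_A, map_one]; ring
/-- the RATIONAL identity at a rational point of `T j`: `ξ³ − (r⁷ + (4j+2) r − (4j+2)) = 0`. -/
theorem ratEq_T (j : ℤ) {ξ r : ℚ} (h : bev (T j) ξ r = 0) : ξ ^ 3 - (r ^ 7 + (4 * j + 2) * r - (4 * j + 2)) = 0 := by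
  have h' : bev (xPolyP 3 (tC j)) ξ r = 0 := h
  have h1 := ratEq_of_bev_lac (k := 3) (c := tC j) (by norm_num) (tC_lac j) h'
  rw [tC_zero, tC_three, map_neg, aeval_A, map_one] at h1
  linear_combination h1

/-- `T j` has NO x-linear presentation (second `x`-difference of `T j (x, 0) = x³ + 4j + 2` is `6 ≠ 0`). -/
theorem T_ne_xLinP (j : ℤ) (A₁ B₁ : ℤ[X]) : T j ≠ xLinP A₁ B₁ := by
  intro hP
  have h := fun x : ℝ => congrArg (fun Q => bev Q x 0) hP
  have h0 := h 0
  have h1 := h 1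
  have h2 := h 2
  simp only [bev_T, bev_xLinP] at h0 h1 h2
  have : (6 : ℝ) = 0 := by linear_combination h0 - 2 * h1 + h2
  norm_num at this
/-- `(j : ℤ) : ¬ XLinearLt (T j)`. -/
theorem not_xLinearLt_T (j : ℤ) : ¬ XLinearLt (T j) := fun ⟨A₁, B₁, _, _, hP⟩ => T_ne_xLinP j A₁ B₁ hP
/-- `(j : ℤ) : ¬ XLinTM (T j)` — outside node 16's record class. -/
theorem not_xLinTM_T (j : ℤ) : ¬ XLinTM (T j) := fun ⟨A₁, B₁, _, _, _, _, hP⟩ => T_ne_xLinP j A₁ B₁ hP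
/-- not a conjugate-poles norm shape of node 10. -/
theorem T_ne_normShapeCurve (j : ℤ) (g q : ℤ[X]) (n : ℕ) (D : ℤ) : T j ≠ normShapeCurve g q n D := by
  rw [normShapeCurve_eq_xLinP]; exact T_ne_xLinP j _ _
/-- **`x`-DEGREE 3 VERSUS 2: `T j` is no `xPolyP 2 c`** (`xCoeff 3`: `1` versus `0`) — hence none of `CB`, `VW`, `SW`,
`dsP`, `quinticP`, `W4P`, node 23's `M j′`. -/
theorem T_ne_xPolyP_two (j : ℤ) (c : ℕ → ℤ[X]) : T j ≠ xPolyP 2 c := by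
  intro h
  have h1 : xCoeff (T j) 3 = xCoeff (xPolyP 2 c) 3 := by rw [h]
  rw [xCoeff_T, tC_three, xCoeff_xPolyP, if_neg (by norm_num)] at h1
  exact one_ne_zero h1
/-- not a cubic-descent curve of node 20. -/
theorem T_ne_CB (j h₁ h₀ l₁ l₀ : ℤ) : T j ≠ CB h₁ h₀ l₁ l₀ := T_ne_xPolyP_two j _
/-- not in node 21's family `VW l`. -/
theorem T_ne_VW (j l : ℤ) : T j ≠ VW l := T_ne_xPolyP_two j _
/-- not in node 22's class `SW e`. -/
theorem T_ne_SW (j e : ℤ) : T j ≠ SW e := T_ne_xPolyP_two j _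
/-- not a descent curve `dsP Q A` of node 19. -/
theorem T_ne_dsP (j : ℤ) (Q A₁ : ℤ[X]) : T j ≠ dsP Q A₁ := T_ne_xPolyP_two j _
/-- not the record's `quinticP`. -/
theorem T_ne_quinticP (j : ℤ) : T j ≠ quinticP := T_ne_xPolyP_two j _
/-- not the standing non-dominant witness `W4P`. -/
theorem T_ne_W4P (j : ℤ) : T j ≠ W4P := T_ne_xPolyP_two j _
/-- not in node 23's family `M j′` (the hyperelliptic sector: `x`-degree 2). -/
theorem T_ne_M (j j' : ℤ) : T j ≠ M j' := T_ne_xPolyP_two j _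
/-- not in node 18's Runge family `RW w` (`xCoeff 5`: `0` versus `Y² − 17`). -/
theorem T_ne_RW (j : ℤ) (w : ℤ[X]) : T j ≠ RW w := by
  intro h
  have h1 : xCoeff (T j) 5 = xCoeff (RW w) 5 := by rw [h]
  rw [xCoeff_T, tC_of_ne j (by norm_num) (by norm_num), RW, xCoeff_xPolyP, if_pos le_rfl, rwC_five] at h1
  exact X_pow_sub_C_ne_zero (by norm_num) 17 h1.symm
/-- not the record's ladder-decided `x`-cubic two-term curve `quartP = x³(Y⁴ + Y) − 2` (`[Y⁴] xCoeff 3`: `0` versus `1`). -/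
theorem T_ne_quartP (j : ℤ) : T j ≠ quartP := by
  intro h
  have h1 : xCoeff (T j) 3 = xCoeff quartP 3 := by rw [h]
  rw [xCoeff_T, tC_three, quartP, twoTermP_eq_xPolyP (by norm_num), xCoeff_xPolyP, if_pos le_rfl, twoTermC_top] at h1
  have h4 := congrArg (fun q : ℤ[X] => q.coeff 4) h1
  simp only [coeff_one, coeff_add, coeff_X_pow, coeff_X] at h4
  norm_num at h4
/-- **`quartP` IS REFUSED BY TYPE** (its top `Y⁴ + Y` dominates its constant `c₀ = −2`: dominance and `2 ≤ deg c₀` fail). -/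
theorem not_domSuper_quartP : ¬ DomSuper quartP := by
  have hB : (X ^ 4 + X : ℤ[X]) ≠ 0 := fun h => by
    have h4 := congrArg (fun q : ℤ[X] => q.coeff 4) h
    simp only [coeff_add, coeff_X_pow, coeff_X, coeff_zero] at h4
    norm_num at h4
  rw [quartP, domSuper_twoTermP_iff (by norm_num) hB]
  rintro ⟨-, hd, -⟩
  rw [natDegree_C] at hd
  exact Nat.not_lt_zero _ hd
/-- node 23's family is REFUSED BY TYPE: `¬ DomSuper (M j′)` (`x`-degree 2). -/
theorem not_domSuper_M (j' : ℤ) : ¬ DomSuper (M j') := not_domSuper_xPolyP_two _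
/-- the standing non-dominant witness is REFUSED BY TYPE: `¬ DomSuper W4P`. -/
theorem not_domSuper_W4P : ¬ DomSuper W4P := not_domSuper_xPolyP_two _

/-- in a presentation `T j = xPolyP k c` with `c k ≠ 0`: `k = 3`, `c 0 = −A_j`, `c 3 = 1`. -/
theorem presentation_T {j : ℤ} {k : ℕ} {c : ℕ → ℤ[X]} (hck : c k ≠ 0) (h : T j = xPolyP k c) :
    k = 3 ∧ c 0 = -A j ∧ c 3 = 1 := by
  have hk : k = 3 := by have := xdeg_xPolyP k c hck; rw [← h, xdeg_T] at this; exact this.symm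
  subst hk
  have h0 := xCoeff_xPolyP 3 c 0
  have h3 := xCoeff_xPolyP 3 c 3
  rw [← h, xCoeff_T, if_pos (by norm_num)] at h0 h3
  rw [tC_zero] at h0
  rw [tC_three] at h3
  exact ⟨rfl, h0.symm, h3.symm⟩
/-- `(j : ℤ) {e : ℕ} (he : e ≤ 6) : ¬ RootlessTop e (T j)` — node 13's class needs `deg c₀ ≤ deg c₃ + e`, i.e. `e ≥ 7`. -/
theorem not_rootlessTop_T (j : ℤ) {e : ℕ} (he : e ≤ 6) : ¬ RootlessTop e (T j) := by
  rintro ⟨k, c, hord, hroot, hP⟩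
  by_cases hck : c k = 0
  · exact hroot 0 (by rw [hck, map_zero])
  obtain ⟨rfl, hc0, hc3⟩ := presentation_T hck hP
  have := hord 0 (by norm_num)
  rw [hc0, hc3, natDegree_neg, natDegree_A, natDegree_one] at this
  omega
/-- … while `RootlessTop 7 (T j)` HOLDS (honest: node 13 decides `T j` at `m₀ ≥ 8` = the `x`-all threshold). -/
theorem rootlessTop_seven_T (j : ℤ) : RootlessTop 7 (T j) :=
  ⟨3, tC j, fun i hi => by
    rw [tC_three, natDegree_one, zero_add]
    interval_cases i
    · rw [tC_zero, natDegree_neg, natDegree_A]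
    · rw [tC_of_ne j (by norm_num) (by norm_num), natDegree_zero]; norm_num
    · rw [tC_of_ne j (by norm_num) (by norm_num), natDegree_zero]; norm_num,
    fun z => by rw [tC_three, map_one]; exact one_ne_zero, rfl⟩
/-- **`¬ DecidedAt m₀ (T j)` for `m₀ ≤ 7`** — each of the five disjuncts of the record's decided class refuted. -/
theorem not_decidedAt_T (j : ℤ) {m₀ : ℕ} (hm : m₀ ≤ 7) : ¬ DecidedAt m₀ (T j) := by
  rintro (h | h | h | h | h)
  · rw [natDegree_T] at h; omega
  · exact not_xLinearLt_T j h
  · obtain ⟨-, A₁, B₁, -, hP⟩ := h; exact T_ne_xLinP j A₁ B₁ hP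
  · rw [thinThreshold_T] at h; omega
  · exact not_rootlessTop_T j (by omega) h
/-- `¬ SlopeCond m₀ 3 (tC j)` for `m₀ ≤ 2` (`deg c₀ − deg c₃ = 7 ≥ 3·m₀`): node 15's slope condition FAILS at `m₀ = 2`. -/
theorem not_slopeCond_tC (j : ℤ) {m₀ : ℕ} (hm : m₀ ≤ 2) : ¬ SlopeCond m₀ 3 (tC j) := fun hS => by
  have := hS 0 (by norm_num) (by rw [tC_zero, tC_three, natDegree_neg, natDegree_A, natDegree_one]; norm_num)
  rw [tC_zero, tC_three, natDegree_neg, natDegree_A, natDegree_one] at this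
  omega
/-- `SlopeCond m₀ 3 (tC j)` for `3 ≤ m₀` (`7 < 9`). -/
theorem slopeCond_tC (j : ℤ) {m₀ : ℕ} (hm : 3 ≤ m₀) : SlopeCond m₀ 3 (tC j) := by
  intro i hi hlt
  interval_cases i
  · rw [tC_zero, tC_three, natDegree_neg, natDegree_A, natDegree_one]; omega
  · rw [tC_three, tC_of_ne j (by norm_num) (by norm_num), natDegree_zero] at hlt
    exact absurd hlt (Nat.not_lt_zero _)
  · rw [tC_three, tC_of_ne j (by norm_num) (by norm_num), natDegree_zero] at hlt
    exact absurd hlt (Nat.not_lt_zero _)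
/-- **`¬ LocalAt m₀ (T j)` for `m₀ ≤ 2`** — node 14 refused (slope condition). -/
theorem not_localAt_T (j : ℤ) {m₀ : ℕ} (hm : m₀ ≤ 2) : ¬ LocalAt m₀ (T j) := by
  rintro ⟨k, c, hck, hP, -, hS⟩
  obtain ⟨rfl, hc0, hc3⟩ := presentation_T hck hP
  have := hS 0 (by norm_num) (by rw [hc0, hc3, natDegree_neg, natDegree_A, natDegree_one]; norm_num)
  rw [hc0, hc3, natDegree_neg, natDegree_A, natDegree_one] at this
  omega
/-- **`¬ GaussAt m₀ (T j)` for `m₀ ≤ 2`** — node 15 refused AT THE RESIDUAL QUALITY (dominance holds, slope fails). -/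
theorem not_gaussAt_T (j : ℤ) {m₀ : ℕ} (hm : m₀ ≤ 2) : ¬ GaussAt m₀ (T j) := fun h => by
  rw [T] at h
  exact not_slopeCond_tC j hm ((gaussAt_xPolyP_iff 3 (tC j) (tC_three_ne_zero j)).mp h).2
/-- … while `GaussAt m₀ (T j)` HOLDS for `3 ≤ m₀` (honest: node 15 decides `T j` at every `m₀ ≥ 3`). -/
theorem gaussAt_T (j : ℤ) {m₀ : ℕ} (hm : 3 ≤ m₀) : GaussAt m₀ (T j) := by
  rw [T]; exact (gaussAt_xPolyP_iff 3 (tC j) (tC_three_ne_zero j)).mpr ⟨domZero_tC j, slopeCond_tC j hm⟩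
/-- `ThinFibreAt m₀ (T j)` for `3 ≤ m₀` BY NODE 15 (one line; the residual quality `m₀ = 2` is NOT so reached). -/
theorem thinFibreAt_T_of_gaussAt (j : ℤ) {m₀ : ℕ} (hm : 3 ≤ m₀) : ThinFibreAt m₀ (T j) :=
  thinFibreAt_of_gaussAt (gaussAt_T j hm)
/-- **NODE 13½'s TWO-TERM LADDER FAILS AT `m₀ = 2`**: its hypothesis `deg_Y < k·m₀` reads `7 < 6`. -/
theorem not_ladder_two_T (j : ℤ) : ¬ (T j).natDegree < 3 * 2 := by rw [natDegree_T]; norm_num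
/-- … while the ladder decides `T j` at every `m₀ ≥ 3` (`7 < 3·m₀`; one line by `thinFibreAt_twoTermP` — honest). -/
theorem thinFibreAt_T_of_ladder (j : ℤ) {m₀ : ℕ} (hm : 3 ≤ m₀) : ThinFibreAt m₀ (T j) := by
  rw [T_eq_twoTermP]
  exact thinFibreAt_twoTermP (by norm_num) 1 (A j) (by rw [← T_eq_twoTermP, natDegree_T]; omega)
/-- `(j : ℤ) : ¬ DomHyper (T j)` — node 23's class refused (`x`-degree 3). -/
theorem not_domHyper_T (j : ℤ) : ¬ DomHyper (T j) := not_domHyper_of_domSuper (domSuper_T j)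
/-- **THE GENUS CERTIFICATE**: the superelliptic curve of `T j` is `y³ = A_j(Y)` with `A_j` a ℚ-IRREDUCIBLE SEPTIC —
smooth, of GENUS SIX (`(3−1)(7−1)/2`; memo: absolutely simple Jacobian, `End = ℤ[ζ₃]`, by Zarhin — cited, not typed). -/
theorem irreducible_A_cert (j : ℤ) : Irreducible ((A j).map (Int.castRingHom ℚ)) ∧ (A j).natDegree = 7 :=
  ⟨irreducible_A_rat j, natDegree_A j⟩

/-- `partialSum 2 1 = 1`: the level-1 abscissa is `s₁ = 1`. -/
theorem partialSum_two_one : partialSum 2 1 = 1 := by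
  rw [partialSum]; simp [Finset.sum_range_succ]; norm_num
/-- **THE ANCHOR POINT `(1, 1) ∈ T j` for EVERY `j`** (`1 − (1 + (4j+2) − (4j+2)) = 0`) — an INTEGRAL abscissa, indeed the
LEVEL-1 abscissa `s₁ = 1`: the member is LOCALLY LIVE at every place and level `1` carries a rational point. -/
theorem bev_T_anchor (j : ℤ) : bev (T j) (((1 : ℤ) : ℚ) : ℝ) (((1 : ℚ)) : ℝ) = 0 := by
  rw [bev_T]; push_cast; ring
/-- `∂/∂x (T j)(x, y) = 3x²`, typed `HasDerivAt`. -/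
theorem hasDerivAt_bev_T_x (j : ℤ) (x y : ℝ) : HasDerivAt (fun x' => bev (T j) x' y) (3 * x ^ 2) x := by
  have h : (fun x' => bev (T j) x' y) = fun x' => x' ^ 3 - (y ^ 7 + (4 * j + 2) * y - (4 * j + 2)) := by
    funext x'; rw [bev_T]
  rw [h]
  have hp : HasDerivAt (fun x' : ℝ => x' ^ 3) (3 * x ^ 2) x := by simpa using hasDerivAt_pow 3 x
  exact hp.sub_const _
/-- `∂/∂Y (T j)(x, y) = −(7y⁶ + 4j + 2)`, typed `HasDerivAt`. -/
theorem hasDerivAt_bev_T_y (j : ℤ) (x y : ℝ) :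
    HasDerivAt (fun y' => bev (T j) x y') (-(7 * y ^ 6 + (4 * j + 2))) y := by
  have h : (fun y' => bev (T j) x y') = fun y' => x ^ 3 - (y' ^ 7 + (4 * j + 2) * y' - (4 * j + 2)) := by
    funext y'; rw [bev_T]
  rw [h]
  have hp : HasDerivAt (fun y' : ℝ => y' ^ 7) (7 * y ^ 6) y := by simpa using hasDerivAt_pow 7 y
  exact (((hp.add ((hasDerivAt_id' y).const_mul _)).sub_const _).const_sub _).congr_deriv (by ring)
/-- **THE ANCHOR POINT IS SMOOTH**: `∂T/∂x (1, 1) = 3 ≠ 0` … -/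
theorem hasDerivAt_T_anchor_x (j : ℤ) :
    HasDerivAt (fun x => bev (T j) x (((1 : ℚ)) : ℝ)) 3 (((1 : ℤ) : ℚ) : ℝ) := by
  have h := hasDerivAt_bev_T_x j (((1 : ℤ) : ℚ) : ℝ) (((1 : ℚ)) : ℝ)
  have h3 : (3 : ℝ) = 3 * (((1 : ℤ) : ℚ) : ℝ) ^ 2 := by push_cast; ring
  rw [h3]; exact h
/-- … and `∂T/∂Y (1, 1) = −(4j + 9)` (non-zero: ODD), so `(1, 1)` is a smooth point in BOTH coordinates. -/
theorem hasDerivAt_T_anchor_y (j : ℤ) :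
    HasDerivAt (fun y => bev (T j) (((1 : ℤ) : ℚ) : ℝ) y) (-(4 * j + 9)) (((1 : ℚ)) : ℝ) := by
  have h := hasDerivAt_bev_T_y j (((1 : ℤ) : ℚ) : ℝ) (((1 : ℚ)) : ℝ)
  have h3 : (-(4 * j + 9) : ℝ) = -(7 * (((1 : ℚ)) : ℝ) ^ 6 + (4 * j + 2)) := by push_cast; ring
  rw [h3]; exact h
/-- `−(4j + 9) ≠ 0` (it is odd). -/
theorem anchor_dy_ne_zero (j : ℤ) : (-(4 * j + 9) : ℝ) ≠ 0 := by
  have h : ((4 * j + 9 : ℤ) : ℝ) ≠ 0 := by exact_mod_cast (show (4 * j + 9 : ℤ) ≠ 0 by omega)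
  push_cast at h
  exact neg_ne_zero.mpr h
/-- **LEVEL `1` IS POINTED**: `1 ∈ LevelSet (T j) 1` (the anchor point `(s₁, 1) = (1, 1)`, non-degenerate: `T j (0, 1) = −1`). -/
theorem one_mem_levelSet_T (j : ℤ) : 1 ∈ LevelSet (T j) 1 := by
  refine ⟨1, by norm_num, ?_, 0, ?_⟩
  · rw [partialSum_two_one, bev_T]; push_cast; ring
  · rw [bev_T]; push_cast; norm_num
/-- node 21's general engine `OddEmptyAt ℓ` is REFUSED at EVERY `ℓ` (the anchor point has integral abscissa). -/
theorem not_oddEmptyAt_T (j : ℤ) (ℓ : ℕ) : ¬ OddEmptyAt ℓ (T j) := by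
  by_cases h1 : ℓ = 1
  · subst h1; rintro ⟨k, c, n, -, -, hprime, -⟩; exact Nat.not_prime_one hprime
  · exact not_oddEmptyAt_of_ratPoint ((1 : ℤ) : ℚ) 1 (by simp [h1]) (bev_T_anchor j)
/-- … and so is the W4-shape engine `TangentEmptyAt ℓ`. -/
theorem not_tangentEmptyAt_T (j : ℤ) (ℓ : ℕ) : ¬ TangentEmptyAt ℓ (T j) := by
  by_cases h1 : ℓ = 1
  · subst h1; rintro ⟨c, n, -, -, -, -, hprime, -⟩; exact Nat.not_prime_one hprime
  · exact not_tangentEmptyAt_of_ratPoint ((1 : ℤ) : ℚ) 1 (by simp [h1]) (bev_T_anchor j)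

/-- every real septic `y⁷ + a·y + b` has a real root (IVT on `[−R, R]`, `R = 1 + |a| + |b|`). -/
theorem exists_root_septic (a b : ℝ) : ∃ y : ℝ, y ^ 7 + a * y + b = 0 := by
  set R : ℝ := 1 + |a| + |b| with hR
  have ha := abs_nonneg a
  have hb := abs_nonneg b
  have hR1 : 1 ≤ R := by rw [hR]; linarith
  have hR7 : R ^ 2 ≤ R ^ 7 := pow_le_pow_right₀ hR1 (by norm_num)
  have hRR : R ^ 2 = R + |a| * R + |b| * R := by rw [hR]; ring
  have haR : -(|a| * R) ≤ a * R ∧ a * R ≤ |a| * R :=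
    ⟨by nlinarith [neg_abs_le a], by nlinarith [le_abs_self a]⟩
  have hbR : |b| ≤ |b| * R := by nlinarith
  have hb1 := le_abs_self b
  have hb2 := neg_abs_le b
  have hcont : Continuous fun y : ℝ => y ^ 7 + a * y + b := by fun_prop
  have hneg : (-R) ^ 7 + a * (-R) + b ≤ 0 := by
    have : (-R) ^ 7 = -(R ^ 7) := by ring
    rw [this]; linarith [haR.1]
  have hpos : 0 ≤ R ^ 7 + a * R + b := by linarith [haR.1]
  obtain ⟨y, -, hy⟩ := intermediate_value_Icc (by linarith : -R ≤ R) hcont.continuousOn (Set.mem_Icc.mpr ⟨hneg, hpos⟩)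
  exact ⟨y, hy⟩
/-- **`T j` IS REAL-LIVE AT EVERY REAL ABSCISSA** (odd `Y`-degree) … -/
theorem exists_real_root_T (j : ℤ) (x : ℝ) : ∃ y : ℝ, bev (T j) x y = 0 := by
  obtain ⟨y, hy⟩ := exists_root_septic (4 * j + 2) (-(4 * j + 2) - x ^ 3)
  exact ⟨y, by rw [bev_T]; linear_combination -hy⟩
/-- **… in particular AT EVERY LEVEL: `∀ j N, ∃ r : ℝ, T j (s_N, r) = 0`.** -/
theorem T_real_live (j : ℤ) (N : ℕ) : ∃ r : ℝ, bev (T j) (partialSum 2 N) r = 0 := exists_real_root_T j _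

end Territory

end Summit.Schanuel.Schanuel.Theorems.RootDecomp1KSuperellipticSiegel

end
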